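import Mathlib
import Literature.NumberTheory.LFunctions.Zhang2022.SkeletonPartThree
import HarnessLib

/-!
# Zhang (2022), typed statements: §14 "Mean-value formula II" — the proof of Proposition 14.1,
# displays (14.1)–(14.8) and every proof-intermediate display (pp. 76–79)

Topic `Literature/NumberTheory/LFunctions/Zhang2022` (Landau–Siegel audit tree; verdict-neutral).
Y. Zhang, *Discrete mean estimates and the Landau–Siegel zero*, arXiv:2211.02515v1 (2022)
[Zhang2022LandauSiegel] — **an unrefereed manuscript under adjudication; every `def … : Prop` below
is a CLAIM OF THE MANUSCRIPT, STATED NOT ASSERTED; nothing here asserts or denies its Theorems 1–2.**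
Locators `[Z22 p.<PDF page>, (<display>) / u<step>, tex L<line of lsz3__2_.tex>]` were read on the page.

What is typed (one declaration per DAG node `Z22:…` of §14; the statement `Prop14.1`, the object
`Θ₂(β,𝐤*,𝐚*)` (u001) and its main term (u002) are the BANKED `Skeleton.Prop141`, `Skeleton.Theta2`,
`Skeleton.main141` — referenced, never restated; `theta2_zero_eq`, `main141_eq` unfold them):

| node | decl | printed |
|---|---|---|
| (14.1), (14.2) | `Eq141`, `Eq142` | `κ*(m) ≪ τ₅(m)`; `a*(n) ≪ 1`, `a*(n) = 0` for `n > 2P₄` |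
| u001, u002 | `theta2_zero_eq`, `main141_eq`, `Prop141Zero` (+ `prop141Zero_of_prop141`) | `Θ₂`; the `β = 0` case the printed proof carries out |
| Prop14.1.pf | `DedProp141`, `DedProp141General` | "reduced to showing (14.5) and (14.6)"; "the general case is almost identical" |
| (14.3), u003 | `Eq143`, `i2Tilde` (+ `DedEq143`) | `Θ₂ = Σ_{ψ∈Ψ} Ĩ₂(ψ) + o(𝔓)` |
| u004, u005, u006 | `Step14u004`, `Step14u005`, `Step14u006a/b` (`i2Star`) | term-by-term integration; `Σ_ψ τ(χψ̄)ψ(m)ψ̄(n)`; `Σ*_ψ Ĩ₂(ψ)` |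
| u007, u008, (14.4) | `Step14u007`, `Step14u008`, `Eq144` | `D̄k̄/p ≡ −p̄/Dk + 1/Dpk`; `Δ₁ ↦ Δ`; (14.4) |
| u009, u010, u011 | `Step14u009`, `Step14u010`, `calS` | the `D = D₁D₂` split; `𝒮(D₁,D₂;p)` |
| (14.5), (14.6) | `Eq145` (`mainSum14`), `Eq146` | the two estimates Prop. 14.1 is reduced to |
| u012, (14.7), u013 | `Step14u012`, `Eq147`, `Step14u013a/b` (`princ147`, `major1413`) | character expansion of `e(−lp̄/Dk)`; principal term `≪ P𝓛ᶜ` |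
| u014, u015 | `Step14u014` (`thetaOne`), `Step14u015` | `τ(θ_k¹)θ_k¹(p)θ_k¹(−l) = τ(χ)μχ(k)χ(−pl)`; the main term |
| (14.8), u016, u017 | `Eq148` (`lhs148`), `Step14u016`, `Step14u017` (`rhs1417`) (+ `DedEq145`, `DedEq148`, `DedEq146`) | the non-principal characters |
| p.77 / p.78 / p.79 prose | `Step14p77`, `Step14p78`, `Step14p79` | `|τ(χψ_p⁰)| = √D`; `τ(ψ̄⁰_{Dk}) = μ(Dk)`; `|τ(θ̄)| ≤ √r` |

Conventions (skel/INTERFACE.md §3): "`X = Y + o(𝔓)`" ↦ `∀ ε > 0, ForAllLarge (… ‖X − Y‖ ≤ ε𝔓)`;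
"`X = Y + O(E)`", "`X ≪ E`" ↦ `∃ C, ForAllLarge (… ‖X − Y‖ ≤ C·E)`; `ε = exp{−c𝓛¹⁰}` (§4 p. 19, tex L1062);
"`T^{−c}`, `D^{−c}`" ↦ `∃ c > 0` (`𝓛ᶜ` ↦ `∃ c`); the implied constants may depend on the implied constants `B` of
(14.1)–(14.2) (`∀ B, ∃ …`). Assumption (A) is the standing hypothesis of §§7–18 and is an antecedent of
every eventual claim. Sums: `Σ_m` a series `∑'`; `Σ_n`, `Σ_d`, `Σ_k` over `1 ≤ · ≤ ⌊2P₄⌋` (by (14.2), as in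
`Skeleton.main141`); `Σ_{(l,k)=1}` the series `∑' l, if (l,k)=1 then … else 0` (as in `Skeleton.main141`);
`p ∼ P` is `p ∈ Skeleton.primeWindow D`; "`Σ*_{ψ (mod p)}`" over primitive `ψ` = the members of `Ψ`
(`Skeleton.Chr D`) with modulus `p`; `p̄` (`p̄p ≡ 1 (mod N)`) is `nInv N p`; `e(y) = exp(2πiy)` is `eAdd`;
Gauss sums to a modulus that is a summation variable use the instance-free `tauSum N θ =
Σ_{a<N} θ(a)e(a/N)` (= the tree's `GammaFactor.tau`, i.e. Mathlib's `gaussSum θ stdAddChar`).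

PRINT DEFECTS, typed as flagged: (i) u009 and u013 print `(κ₁∗b)(…)` where `κ*` is meant (the §15
specialisation `κ* = κ₁∗b`, tex L4086, leaked into §14; u009 is asserted to EQUAL the innermost sum of
(14.4), whose summand is `κ*(dl)`) — typed with `κ*`, flagged in the docstrings; (ii) the right side of
(14.5) prints `Δ(l/(Dpk))` with `p` unbound — the `Σ_{p∼P}` of the left side is carried on the right
(the reading of Prop. 14.1's main term and of u015 summed over `p`), flagged; (iii) (14.8) prints `θ(l)`
where (14.7) has `θ(−l)` (same absolute value) — typed as printed.

Deliberately NOT here: proofs of the claims (dischargers' work), the §15 objects `κ₁`, `b` (L4), any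
restatement of `Skeleton.Prop141/Theta2/main141`.

## References

* Y. Zhang, arXiv:2211.02515v1 (2022), §14 pp. 76–79, (14.1)–(14.8); §2 (2.5); §5 (5.6)–(5.7),
  Lemmas 5.3, 5.4, 5.6; §7 (7.3)–(7.7). [cite: Zhang2022LandauSiegel, §14]
-/

noncomputable section

open Complex Real ComplexConjugate

namespace Literature.NumberTheory.LFunctions.Zhang2022.Typed.Sec14

open Skeleton

/-! ## Small instance-free helpers -/

/-- `e(y) = exp(2πiy)` (the additive character of (5.7), `Δ(x) = Δ₁(x)e(x)`).
[cite: Zhang2022LandauSiegel, §5 (5.7) p.25] -/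
def eAdd (y : ℝ) : ℂ := cexp (2 * π * I * y)

/-- The Gauss sum `τ(θ) = Σ_{a (mod N)} θ(a)e(a/N)` of a character `θ (mod N)`, written as a sum over the
representatives `0 ≤ a < N` so that no `NeZero N` instance is needed when `N` is a summation variable
(for `N ≠ 0` this is the tree's `GammaFactor.tau θ` = Mathlib's `gaussSum θ stdAddChar`, `tauSum_eq_tau`).
[cite: Zhang2022LandauSiegel, §2 (2.2) p.4] -/
def tauSum (N : ℕ) (θ : DirichletCharacter ℂ N) : ℂ :=
  ∑ a ∈ Finset.range N, θ (a : ZMod N) * eAdd ((a : ℝ) / N)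

/-- `ā (mod N)`: the least residue of the inverse of `a` modulo `N` ("`p̄p ≡ 1 (mod Dk)`", p. 77;
junk when `(a,N) > 1`). [cite: Zhang2022LandauSiegel, §14 (14.4) p.77] -/
def nInv (N a : ℕ) : ℕ := ((a : ZMod N)⁻¹).val

/-- `tauSum` is the Gauss sum `GammaFactor.tau` (Mathlib's `gaussSum θ stdAddChar`) for `N ≠ 0`.
[cite: Zhang2022LandauSiegel, §2 (2.2) p.4] -/
theorem tauSum_eq_tau {N : ℕ} [NeZero N] (θ : DirichletCharacter ℂ N) :
    tauSum N θ = GammaFactor.tau θ := by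
  rw [GammaFactor.tau, gaussSum, tauSum]
  refine Finset.sum_nbij' (fun a : ℕ => (a : ZMod N)) (fun z : ZMod N => z.val)
    (fun _ _ => Finset.mem_univ _) (fun z _ => Finset.mem_range.mpr (ZMod.val_lt z))
    (fun a ha => ZMod.val_natCast_of_lt (Finset.mem_range.mp ha)) (fun z _ => ZMod.natCast_zmod_val z)
    (fun a _ => ?_)
  rw [ZMod.stdAddChar_apply, ZMod.toCircle_natCast, eAdd]
  congr 1
  push_cast
  ring_nf

/-! ## (14.1), (14.2): the standing hypotheses on `𝐤*`, `𝐚*` -/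

/-- `Z22:(14.1)` HYPOTHESIS. **(14.1)** "`κ*(m) ≪ τ₅(m)`", with the implied constant `B` explicit (`τ₅ = ζ^{∗5}`, the number of
ordered factorisations into five factors; the same shape as the hypothesis of `Skeleton.Prop141`).
[cite: Zhang2022LandauSiegel, §14 (14.1) p.76, tex L3828] -/
def Eq141 (B : ℝ) (κs : ℕ → ℂ) : Prop :=
  ∀ m : ℕ, ‖κs m‖ ≤ B * ((ArithmeticFunction.zeta ^ 5 : ArithmeticFunction ℕ) m : ℝ)

/-- `Z22:(14.2)` HYPOTHESIS. **(14.2)** "`a*(n) ≪ 1`, `a*(n) = 0` if `n > 2P₄`" (`P₄ = PT⁻²t₀`), implied constant `B`.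
[cite: Zhang2022LandauSiegel, §14 (14.2) p.76, tex L3831] -/
def Eq142 (D : ℕ) (B : ℝ) (as : ℕ → ℂ) : Prop :=
  (∀ n : ℕ, ‖as n‖ ≤ B) ∧ ∀ n : ℕ, 2 * P4 D < n → as n = 0

variable {D : ℕ} [NeZero D] (χ : DirichletCharacter ℂ D)

/-! ## u001–u003: `Θ₂`, `Ĩ₂(ψ)`, and Proposition 14.1 at `β = 0` -/

variable (x : Chr D) in
/-- `Z22:§14.u003` OBJECT. **`Ĩ₂(ψ) = (1/2πi)∫_{𝔍(1)} Z(s,ψχ)⁻¹(Σ_m κ*(m)ψ(m)m^{−s})(Σ_n a*(n)ψ̄(n)n^{s−1})ω(s)ds`** (u003) —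
the integrand of the banked `Skeleton.Theta2` for one `ψ ∈ Ψ`.
[cite: Zhang2022LandauSiegel, §14 u003 p.76, tex L3854] -/
def i2Tilde (κs as : ℕ → ℂ) : ℂ :=
  Lemma81.segInt (t0 D) (ell1 D) 1 fun s =>
    (Zpc χ x s)⁻¹ * (∑' m : ℕ, κs m * x.ψ (m : ZMod x.p) * (m : ℂ) ^ (-s)) *
      (∑ n ∈ Finset.Icc 1 ⌊2 * P4 D⌋₊, as n * conj (x.ψ (n : ZMod x.p)) * (n : ℂ) ^ (s - 1)) *
      omegaW D s

/-- `Z22:§14.u001` (banked `Skeleton.Theta2`) at `β = 0`: "Write `Θ₂` for `Θ₂(0,𝐤*,𝐚*)`" — the banked `Skeleton.Theta2 χ 0 𝐤* 𝐚*` is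
`Σ_{ψ∈Ψ₁} Ĩ₂(ψ)` (kernel-checked unfolding; `(p_ψt₀)⁰ = 1`).
[cite: Zhang2022LandauSiegel, §14 u001 p.76, tex L3834] -/
theorem theta2_zero_eq (κs as : ℕ → ℂ) :
    Theta2 χ 0 κs as = ∑ x ∈ finsetOf (PsiOne χ), i2Tilde χ x κs as := by
  unfold Theta2 i2Tilde
  exact Finset.sum_congr rfl fun x _ => by rw [Complex.cpow_zero, one_mul]

/-- `Z22:§14.u002` OBJECT (part of the banked `Skeleton.main141`). The inner triple sum of the main term of Proposition 14.1 for one `p`: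
`Σ_d d⁻¹ Σ_k μχ(k)a*(dk)/(kφ(k)) Σ_{(l,k)=1} χ(l)κ*(dl)Δ(l/(Dpk))` (u002; also the right sides of
(14.5) and u015). [cite: Zhang2022LandauSiegel, §14 Prop. 14.1 p.76, tex L3842] -/
def mainSum14 (p : ℕ) (κs as : ℕ → ℂ) : ℂ :=
  ∑ d ∈ Finset.Icc 1 ⌊2 * P4 D⌋₊, (d : ℂ)⁻¹ *
    ∑ k ∈ Finset.Icc 1 ⌊2 * P4 D⌋₊,
      (ArithmeticFunction.moebius k : ℂ) * χ (k : ZMod D) * as (d * k) / ((k : ℂ) * Nat.totient k) *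
        ∑' l : ℕ, if Nat.Coprime l k then
          χ (l : ZMod D) * κs (d * l) * DeltaW D ((l : ℝ) / ((D : ℝ) * p * k)) else 0

omit [NeZero D] in
/-- `Z22:§14.u002`: the banked main term `Skeleton.main141 χ β 𝐤* 𝐚*` is `φ(D)⁻¹Σ_{p∼P}(pt₀)^β · mainSum14`
(definitional). [cite: Zhang2022LandauSiegel, §14 Prop. 14.1 p.76, tex L3842] -/
theorem main141_eq (β : ℂ) (κs as : ℕ → ℂ) :
    main141 χ β κs as = (Nat.totient D : ℂ)⁻¹ *
      ∑ p ∈ primeWindow D, (((p : ℝ) * t0 D : ℝ) : ℂ) ^ β * mainSum14 χ p κs as := rfl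

/-- `Z22:Prop14.1` at `β = 0` (the banked node is `Skeleton.Prop141`) CLAIM. **Proposition 14.1 in the case `β = 0`** — the case the printed proof carries out ("We prove this
proposition with `β = 0` only", p. 76): `Θ₂(0,𝐤*,𝐚*) = φ(D)⁻¹Σ_{p∼P}Σ_d … + o(𝔓)` under (14.1)–(14.2).
A specialisation of the banked `Skeleton.Prop141` (`prop141Zero_of_prop141`), not a restatement. CLAIM.
[cite: Zhang2022LandauSiegel, §14 Prop. 14.1 p.76, tex L3841–L3849] -/
def Prop141Zero : Prop :=
  ∀ B : ℝ, ∀ ε : ℝ, 0 < ε → ForAllLarge fun D _ χ => AssumptionA D χ → ∀ κs as : ℕ → ℂ,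
    Eq141 B κs → Eq142 D B as → ‖Theta2 χ 0 κs as - main141 χ 0 κs as‖ ≤ ε * frakP D

/-- `log D ≥ 2` once `D ≥ 8` (so that `α = π𝓛⁻⁹ > 0`). [folklore] -/
private theorem two_le_log_of_eight_le {D : ℕ} (hD : 8 ≤ D) : 2 ≤ Real.log D := by
  have h8 : (8 : ℝ) ≤ D := by exact_mod_cast hD
  have : Real.exp 2 ≤ 8 := by
    have h1 := Real.exp_one_lt_d9
    have h2 : Real.exp 2 = Real.exp 1 * Real.exp 1 := by rw [← Real.exp_add]; norm_num
    nlinarith [Real.exp_pos 1]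
  calc (2 : ℝ) = Real.log (Real.exp 2) := (Real.log_exp 2).symm
    _ ≤ Real.log D := Real.log_le_log (Real.exp_pos 2) (this.trans h8)

/-- The banked Proposition 14.1 implies its `β = 0` case (`‖0‖ < 5α` since `α = π/𝓛⁹ > 0` for `D ≥ 8`).
[cite: Zhang2022LandauSiegel, §14 Prop. 14.1 p.76] -/
theorem prop141Zero_of_prop141 (h : Prop141) : Prop141Zero := by
  intro B ε hε
  obtain ⟨D₀, hD₀⟩ := h B ε hε
  refine ⟨max D₀ 8, fun D _ χ hD hq hp hA κs as h1 h2 => ?_⟩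
  have hD8 : 8 ≤ D := le_trans (le_max_right _ _) hD
  have hα : 0 < alpha D := by
    rw [alpha, bigP, Real.log_exp, ell]
    exact div_pos Real.pi_pos (pow_pos (by linarith [two_le_log_of_eight_le hD8]) 9)
  exact hD₀ D χ (le_trans (le_max_left _ _) hD) hq hp hA 0 (by simpa using hα) κs as h1 h2.1 h2.2

/-! ## (14.3) and the term-by-term integration u004 -/

/-- `Z22:(14.3)` CLAIM. **(14.3)** (p. 76): "Similar to the proof of Proposition 7.1, … we can extend the sum over `Ψ₁` to
the sum over `Ψ`, with acceptable errors. Namely `Θ₂ = Σ_{ψ∈Ψ} Ĩ₂(ψ) + o(𝔓)`" (`Θ₂ = Θ₂(0,𝐤*,𝐚*)`;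
`Ψ` = all of `Skeleton.Chr D`). CLAIM. [cite: Zhang2022LandauSiegel, §14 (14.3) p.76, tex L3850] -/
def Eq143 : Prop :=
  ∀ B : ℝ, ∀ ε : ℝ, 0 < ε → ForAllLarge fun D _ χ => AssumptionA D χ → ∀ κs as : ℕ → ℂ,
    Eq141 B κs → Eq142 D B as →
      ‖Theta2 χ 0 κs as - ∑ x ∈ finsetOf (Set.univ : Set (Chr D)), i2Tilde χ x κs as‖ ≤ ε * frakP D

/-- `Z22:(14.3)` DEDUCTION CLAIM. **(14.3) ⇐ "similar to the proof of Proposition 7.1"** (the (7.3)–(7.5) method: Proposition 2.1,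
Cauchy's inequality and the large sieve / Lemma 3.3), as a named implication. CLAIM.
[cite: Zhang2022LandauSiegel, §14 (14.3) p.76, tex L3849; §7 (7.3)–(7.5) pp.33–34] -/
def DedEq143 : Prop := Prop21 → Lemma33a → Lemma33b → Eq143

variable (x : Chr D) in
/-- `Z22:§14.u004` CLAIM (pointwise form). **u004** (p. 76): for `ψ (mod p) ∈ Ψ`, "We use (2.5) with `θ = ψχ` and then replace the segment `𝔍(1)`
by the vertical line `σ = 3/2` with a negligible error. Thus, by integration term by term,
`Ĩ₂(ψ) = τ(χψ̄)/(Dp) Σ_m Σ_n κ*(m)a*(n)ψ(m)ψ̄(n)/n · Δ₁(m/(Dpn)) + O(ε)`", `ε = exp{−c𝓛¹⁰}`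
(`τ(χψ̄) = τ((ψχ)⁻¹)` to the modulus `Dp`; `Δ₁` of (5.6) at `(𝓛₂,t₀)` is the tree's `Lemma53.Delta1_56`).
CLAIM. [cite: Zhang2022LandauSiegel, §14 u004 p.76, tex L3858] -/
def Step14u004At (c C B : ℝ) (κs as : ℕ → ℂ) : Prop :=
  Eq141 B κs → Eq142 D B as →
    ‖i2Tilde χ x κs as - GammaFactor.tau (psiChi χ x)⁻¹ / ((D : ℂ) * x.p) *
        ∑' m : ℕ, ∑ n ∈ Finset.Icc 1 ⌊2 * P4 D⌋₊,
          κs m * as n * x.ψ (m : ZMod x.p) * conj (x.ψ (n : ZMod x.p)) / (n : ℂ) *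
            Lemma53.Delta1_56 (ell2 D) (t0 D) ((m : ℝ) / ((D : ℝ) * x.p * n))‖
      ≤ C * Real.exp (-c * ell D ^ 10)

/-- `Z22:§14.u004` CLAIM. **u004**, quantified: for every `B` there are `c > 0`, `C` with `Step14u004At` for all large `D`,
all `ψ ∈ Ψ` and all `𝐤*, 𝐚*` subject to (14.1)–(14.2). CLAIM.
[cite: Zhang2022LandauSiegel, §14 u004 p.76, tex L3858] -/
def Step14u004 : Prop :=
  ∀ B : ℝ, ∃ c : ℝ, 0 < c ∧ ∃ C : ℝ, ForAllLarge fun D _ χ => AssumptionA D χ →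
    ∀ x : Chr D, ∀ κs as : ℕ → ℂ, Step14u004At χ x c C B κs as

/-! ## u005–u006: summing over the characters `ψ (mod p)` -/

/-- `Z22:§14.u005` CLAIM. **u005** (p. 76): "For `(mn,p) = 1` we have `Σ_{ψ (mod p)} τ(χψ̄)ψ(m)ψ̄(n) = τ(χ)χ(p)(p−1)e(mD̄n̄/p)`"
(all characters `ψ (mod p)`; `χψ̄` to the modulus `Dp`; `D̄n̄·Dn ≡ 1 (mod p)`), for `p ∼ P` and `D`
large. CLAIM. [cite: Zhang2022LandauSiegel, §14 u005 p.76, tex L3862] -/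
def Step14u005 : Prop :=
  ForAllLarge fun D _ χ => ∀ p ∈ primeWindow D, ∀ m n : ℕ, Nat.Coprime (m * n) p →
    (∑ ψ ∈ finsetOf (Set.univ : Set (DirichletCharacter ℂ p)),
        tauSum (D * p) (DirichletCharacter.changeLevel (dvd_mul_right D p) χ *
            DirichletCharacter.changeLevel (dvd_mul_left p D) ψ⁻¹) *
          ψ (m : ZMod p) * ψ⁻¹ (n : ZMod p)) =
      GammaFactor.tau χ * χ (p : ZMod D) * ((p : ℂ) - 1) *
        eAdd ((m : ℝ) * nInv p (D * n) / p)

/-- `Z22:§14.u006` OBJECT. **`Σ*_{ψ (mod p)} Ĩ₂(ψ)`**: the sum of `Ĩ₂(ψ)` over the primitive characters `ψ (mod p)`, i.e. over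
the members of `Ψ` with modulus `p` (u006, (14.4), u010). [cite: Zhang2022LandauSiegel, §14 u006 p.77, tex L3866] -/
def i2Star (p : ℕ) (κs as : ℕ → ℂ) : ℂ :=
  ∑ x ∈ finsetOf {x : Chr D | x.p = p}, i2Tilde χ x κs as

/-- `Z22:§14.u006` CLAIM (first line). **u006** (p. 77): "Note that `(n,p) = 1` if `n < 2P₄` and `|τ(χψ_p⁰)| = √D`. Hence …
`Σ*_{ψ (mod p)} Ĩ₂(ψ) = τ(χ)χ(p)/D Σ_mΣ_n κ*(m)a*(n)/n Δ₁(m/(Dpn)) e(mD̄n̄/p) + O(PT^{−c})`". CLAIM.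
[cite: Zhang2022LandauSiegel, §14 u006 p.77, tex L3866] -/
def Step14u006a : Prop :=
  ∀ B : ℝ, ∃ c : ℝ, 0 < c ∧ ∃ C : ℝ, ForAllLarge fun D _ χ => AssumptionA D χ →
    ∀ p ∈ primeWindow D, ∀ κs as : ℕ → ℂ, Eq141 B κs → Eq142 D B as →
      ‖i2Star χ p κs as - GammaFactor.tau χ * χ (p : ZMod D) / D *
          ∑' m : ℕ, ∑ n ∈ Finset.Icc 1 ⌊2 * P4 D⌋₊, κs m * as n / (n : ℂ) *
            Lemma53.Delta1_56 (ell2 D) (t0 D) ((m : ℝ) / ((D : ℝ) * p * n)) *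
              eAdd ((m : ℝ) * nInv p (D * n) / p)‖
        ≤ C * bigP D * bigT D ^ (-c)

/-- `Z22:§14.u006` CLAIM (second line). **u006** (p. 77): "substituting `d = (m,n)`, `m = dl`, `n = dk` and inverting the order of
summation … `= τ(χ)χ(p)/D Σ_d d⁻¹ Σ_k a*(dk)/k Σ_{(l,k)=1} κ*(dl)Δ₁(l/(Dpk))e(lD̄k̄/p) + O(PT^{−c})`
(here we have replaced the constraint `(l,pk) = 1` by `(l,k) = 1` with an acceptable error, and used a
bound for `|Δ₁(x)| = |Δ(x)|` given by Lemma 5.3)". CLAIM.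
[cite: Zhang2022LandauSiegel, §14 u006 p.77, tex L3866–L3871] -/
def Step14u006b : Prop :=
  ∀ B : ℝ, ∃ c : ℝ, 0 < c ∧ ∃ C : ℝ, ForAllLarge fun D _ χ => AssumptionA D χ →
    ∀ p ∈ primeWindow D, ∀ κs as : ℕ → ℂ, Eq141 B κs → Eq142 D B as →
      ‖i2Star χ p κs as - GammaFactor.tau χ * χ (p : ZMod D) / D *
          ∑ d ∈ Finset.Icc 1 ⌊2 * P4 D⌋₊, (d : ℂ)⁻¹ * ∑ k ∈ Finset.Icc 1 ⌊2 * P4 D⌋₊,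
            as (d * k) / (k : ℂ) * ∑' l : ℕ, if Nat.Coprime l k then
              κs (d * l) * Lemma53.Delta1_56 (ell2 D) (t0 D) ((l : ℝ) / ((D : ℝ) * p * k)) *
                eAdd ((l : ℝ) * nInv p (D * k) / p) else 0‖
        ≤ C * bigP D * bigT D ^ (-c)

/-! ## u007, u008, (14.4): from `Δ₁` to `Δ` -/

/-- `Z22:§14.u007` CLAIM. **u007** (p. 77): "`D̄k̄/p ≡ −p̄/(Dk) + 1/(Dpk) (mod 1)`" with `D̄k̄·Dk ≡ 1 (mod p)`, `p̄p ≡ 1 (mod Dk)`,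
for a prime `p` with `(p, Dk) = 1`. CLAIM (elementary).
[cite: Zhang2022LandauSiegel, §14 u007 p.77, tex L3873] -/
def Step14u007 : Prop :=
  ∀ D k p : ℕ, 0 < D → 0 < k → p.Prime → Nat.Coprime p (D * k) →
    ∃ N : ℤ, (nInv p (D * k) : ℝ) / p = -((nInv (D * k) p : ℝ) / (D * k)) + 1 / ((D : ℝ) * p * k) + N

/-- `Z22:§14.u008` CLAIM. **u008** (p. 77): "it follows that `Δ₁(l/(Dpk))e(lD̄k̄/p) = Δ(l/(Dpk))e(−lp̄/(Dk))` with
`p̄p ≡ 1 (mod Dk)`" (`Δ = Δ₁·e`, (5.7)). CLAIM. [cite: Zhang2022LandauSiegel, §14 u008 p.77, tex L3877] -/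
def Step14u008 : Prop :=
  ∀ D k p l : ℕ, 0 < D → 0 < k → p.Prime → Nat.Coprime p (D * k) →
    Lemma53.Delta1_56 (ell2 D) (t0 D) ((l : ℝ) / ((D : ℝ) * p * k)) *
        eAdd ((l : ℝ) * nInv p (D * k) / p) =
      DeltaW D ((l : ℝ) / ((D : ℝ) * p * k)) * eAdd (-((l : ℝ) * nInv (D * k) p / (D * k)))

/-- `Z22:(14.4)` CLAIM. **(14.4)** (p. 77): "Hence `Σ*_{ψ (mod p)} Ĩ₂(ψ) = τ(χ)χ(p)/D Σ_d d⁻¹ Σ_k a*(dk)/k Σ_{(l,k)=1}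
κ*(dl)Δ(l/(Dpk))e(−lp̄/(Dk)) + O(PT^{−c})`". CLAIM. [cite: Zhang2022LandauSiegel, §14 (14.4) p.77, tex L3882] -/
def Eq144 : Prop :=
  ∀ B : ℝ, ∃ c : ℝ, 0 < c ∧ ∃ C : ℝ, ForAllLarge fun D _ χ => AssumptionA D χ →
    ∀ p ∈ primeWindow D, ∀ κs as : ℕ → ℂ, Eq141 B κs → Eq142 D B as →
      ‖i2Star χ p κs as - GammaFactor.tau χ * χ (p : ZMod D) / D *
          ∑ d ∈ Finset.Icc 1 ⌊2 * P4 D⌋₊, (d : ℂ)⁻¹ * ∑ k ∈ Finset.Icc 1 ⌊2 * P4 D⌋₊,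
            as (d * k) / (k : ℂ) * ∑' l : ℕ, if Nat.Coprime l k then
              κs (d * l) * DeltaW D ((l : ℝ) / ((D : ℝ) * p * k)) *
                eAdd (-((l : ℝ) * nInv (D * k) p / (D * k))) else 0‖
        ≤ C * bigP D * bigT D ^ (-c)

/-! ## u009–u011: the split `D = D₁D₂` and `𝒮(D₁,D₂;p)` -/

/-- `Z22:§14.u009` CLAIM. **u009** (p. 77): "Assume `(k,p) = 1`. If `(l,k) = 1` and `(l,D) = D₁`, then `(k,D₁) = 1`. Thus,
substituting `(l,D) = D₁` and `l = D₁l₁`, the innermost sum in (14.4) is equal to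
`Σ_{D=D₁D₂, (D₁,k)=1} Σ_{(l₁,D₂k)=1} κ*(D₁dl₁)Δ(l₁/(D₂pk))e(−l₁p̄/(D₂k))`" (`p̄` to the modulus `D₂k`;
the same value as with `p̄ (mod Dk)`). PRINT DEFECT: the display prints `(κ₁∗b)(D₁dl₁)` — `κ₁`, `b` are
the §15 objects of the specialisation `κ* = κ₁∗b` (tex L4086); since the display is asserted to equal the
innermost sum of (14.4) (summand `κ*(dl)`), it is typed with `κ*`. CLAIM.
[cite: Zhang2022LandauSiegel, §14 u009 p.77, tex L3891] -/
def Step14u009 : Prop :=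
  ∀ B : ℝ, ForAllLarge fun D _ _ => ∀ p ∈ primeWindow D, ∀ κs : ℕ → ℂ, Eq141 B κs →
    ∀ d k : ℕ, 1 ≤ d → 1 ≤ k → Nat.Coprime k p →
      (∑' l : ℕ, if Nat.Coprime l k then
          κs (d * l) * DeltaW D ((l : ℝ) / ((D : ℝ) * p * k)) *
            eAdd (-((l : ℝ) * nInv (D * k) p / (D * k))) else 0) =
        ∑ e ∈ (Nat.divisorsAntidiagonal D).filter (fun e => Nat.Coprime e.1 k),
          ∑' l₁ : ℕ, if Nat.Coprime l₁ (e.2 * k) then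
            κs (e.1 * d * l₁) * DeltaW D ((l₁ : ℝ) / ((e.2 : ℝ) * p * k)) *
              eAdd (-((l₁ : ℝ) * nInv (e.2 * k) p / (e.2 * k))) else 0

/-- `Z22:§14.u011` OBJECT. **`𝒮(D₁,D₂;p) = Σ_d d⁻¹ Σ_{(k,D₁)=1} a*(dk)/k Σ_{(l,D₂k)=1} κ*(D₁dl)Δ(l/(D₂pk))e(−lp̄/(D₂k))`** (u011;
`p̄p ≡ 1 (mod D₂k)`; `Δ` at the parameters `(𝓛₂,t₀)` of `D`). [cite: Zhang2022LandauSiegel, §14 u011 p.77, tex L3901] -/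
def calS (D D₁ D₂ p : ℕ) (κs as : ℕ → ℂ) : ℂ :=
  ∑ d ∈ Finset.Icc 1 ⌊2 * P4 D⌋₊, (d : ℂ)⁻¹ *
    ∑ k ∈ (Finset.Icc 1 ⌊2 * P4 D⌋₊).filter (fun k => Nat.Coprime k D₁), as (d * k) / (k : ℂ) *
      ∑' l : ℕ, if Nat.Coprime l (D₂ * k) then
        κs (D₁ * d * l) * DeltaW D ((l : ℝ) / ((D₂ : ℝ) * p * k)) *
          eAdd (-((l : ℝ) * nInv (D₂ * k) p / (D₂ * k))) else 0

/-- `Z22:§14.u010` CLAIM. **u010** (p. 77): "Inserting this into (14.4) and rearranging the terms we conclude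
`Σ*_{ψ (mod p)} Ĩ₂(ψ) = τ(χ)χ(p)/D Σ_{D=D₁D₂} 𝒮(D₁,D₂;p) + O(PT^{−c})`". CLAIM.
[cite: Zhang2022LandauSiegel, §14 u010 p.77, tex L3896] -/
def Step14u010 : Prop :=
  ∀ B : ℝ, ∃ c : ℝ, 0 < c ∧ ∃ C : ℝ, ForAllLarge fun D _ χ => AssumptionA D χ →
    ∀ p ∈ primeWindow D, ∀ κs as : ℕ → ℂ, Eq141 B κs → Eq142 D B as →
      ‖i2Star χ p κs as - GammaFactor.tau χ * χ (p : ZMod D) / D *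
          ∑ e ∈ Nat.divisorsAntidiagonal D, calS D e.1 e.2 p κs as‖ ≤ C * bigP D * bigT D ^ (-c)

/-! ## (14.5), (14.6): what Proposition 14.1 is reduced to -/

/-- `Z22:(14.5)` CLAIM. **(14.5)** (p. 78): "Since `χ(−1)τ(χ)² = D`, the proof of Proposition 14.1 is now reduced to showing
that `Σ_{p∼P} χ(p)𝒮(1,D;p) = χ(−1)τ(χ)/φ(D) Σ_d d⁻¹ Σ_k μχ(k)a*(dk)/(kφ(k)) Σ_{(l,k)=1} χ(l)κ*(dl)Δ(l/(Dpk))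
+ O(P²D^{1/2−c})`". PRINT DEFECT: the right side prints `Δ(l/(Dpk))` with `p` not bound; it is typed
with the `Σ_{p∼P}` of the left side carried on the right (the only reading under which (14.5) yields the
main term of Proposition 14.1, and the sum over `p` of u015). CLAIM.
[cite: Zhang2022LandauSiegel, §14 (14.5) p.78, tex L3908] -/
def Eq145 : Prop :=
  ∀ B : ℝ, ∃ c : ℝ, 0 < c ∧ ∃ C : ℝ, ForAllLarge fun D _ χ => AssumptionA D χ →
    ∀ κs as : ℕ → ℂ, Eq141 B κs → Eq142 D B as →
      ‖(∑ p ∈ primeWindow D, χ (p : ZMod D) * calS D 1 D p κs as) -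
          χ (-1) * GammaFactor.tau χ / Nat.totient D * ∑ p ∈ primeWindow D, mainSum14 χ p κs as‖
        ≤ C * bigP D ^ 2 * (D : ℝ) ^ (1 / 2 - c)

/-- `Z22:(14.6)` CLAIM. **(14.6)** (p. 78): "and, for `D = D₁D₂`, `D₁ > 1`, `Σ_{p∼P} χ(p)𝒮(D₁,D₂;p) ≪ P²D^{1/2−c}`". CLAIM.
[cite: Zhang2022LandauSiegel, §14 (14.6) p.78, tex L3915] -/
def Eq146 : Prop :=
  ∀ B : ℝ, ∃ c : ℝ, 0 < c ∧ ∃ C : ℝ, ForAllLarge fun D _ χ => AssumptionA D χ →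
    ∀ κs as : ℕ → ℂ, Eq141 B κs → Eq142 D B as → ∀ D₁ D₂ : ℕ, D₁ * D₂ = D → 1 < D₁ →
      ‖∑ p ∈ primeWindow D, χ (p : ZMod D) * calS D D₁ D₂ p κs as‖
        ≤ C * bigP D ^ 2 * (D : ℝ) ^ (1 / 2 - c)

/-- `Z22:Prop14.1.pf` DEDUCTION CLAIM. **Proof node of Proposition 14.1** (p. 78: "the proof of Proposition 14.1 is now reduced to showing
(14.5) and (14.6)", via (14.3), u010 and `χ(−1)τ(χ)² = D`), as a named implication to the `β = 0` case
that the printed proof treats. CLAIM. [cite: Zhang2022LandauSiegel, §14 Prop. 14.1 (proof) pp.76–78, tex L3849–L3917] -/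
def DedProp141 : Prop := Eq143 → Step14u010 → Eq145 → Eq146 → Prop141Zero

/-- `Z22:Prop14.1.pf` DEDUCTION CLAIM (general `β`). **"as the general case is almost identical"** (p. 76): the `β = 0` case yields Proposition 14.1 for
all `|β| < 5α`. CLAIM (no argument is printed). [cite: Zhang2022LandauSiegel, §14 Prop. 14.1 (proof) p.76, tex L3849] -/
def DedProp141General : Prop := Prop141Zero → Prop141

/-! ## u012, (14.7): the character expansion of `e(−lp̄/(Dk))` -/

/-- `Z22:§14.u012` CLAIM. **u012** (p. 78): "Assume `k < 2P₄` and `(l,Dk) = 1`. Then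
`e(−lp̄/(Dk)) = φ(Dk)⁻¹ Σ_{θ (mod Dk)} τ(θ̄)θ(−l)θ̄(p)`" (all characters `θ (mod Dk)`; `(p,Dk) = 1`).
CLAIM. [cite: Zhang2022LandauSiegel, §14 u012 p.78, tex L3920] -/
def Step14u012 : Prop :=
  ∀ D k p l : ℕ, 0 < D → 0 < k → Nat.Coprime l (D * k) → Nat.Coprime p (D * k) →
    eAdd (-((l : ℝ) * nInv (D * k) p / (D * k))) =
      (Nat.totient (D * k) : ℂ)⁻¹ *
        ∑ θ ∈ finsetOf (Set.univ : Set (DirichletCharacter ℂ (D * k))),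
          tauSum (D * k) θ⁻¹ * θ (-(l : ZMod (D * k))) * θ⁻¹ (p : ZMod (D * k))

/-- `Z22:(14.7)` CLAIM. **(14.7)** (p. 78): "Hence `𝒮(1,D;p) = Σ_d d⁻¹ Σ_k a*(dk)/(kφ(Dk)) Σ_{θ (mod Dk)} τ(θ̄)θ̄(p) Σ_l
κ*(dl)θ(−l)Δ(l/(Dpk))` (here we have removed the constraint `(l,Dk) = 1` as it is superfluous)", for
`p ∼ P` under (14.1)–(14.2). CLAIM. [cite: Zhang2022LandauSiegel, §14 (14.7) p.78, tex L3924] -/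
def Eq147 : Prop :=
  ∀ B : ℝ, ForAllLarge fun D _ _ => ∀ p ∈ primeWindow D, ∀ κs as : ℕ → ℂ,
    Eq141 B κs → Eq142 D B as →
      calS D 1 D p κs as =
        ∑ d ∈ Finset.Icc 1 ⌊2 * P4 D⌋₊, (d : ℂ)⁻¹ * ∑ k ∈ Finset.Icc 1 ⌊2 * P4 D⌋₊,
          as (d * k) / ((k : ℂ) * Nat.totient (D * k)) *
            ∑ θ ∈ finsetOf (Set.univ : Set (DirichletCharacter ℂ (D * k))),
              tauSum (D * k) θ⁻¹ * θ⁻¹ (p : ZMod (D * k)) *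
                ∑' l : ℕ, κs (d * l) * θ (-(l : ZMod (D * k))) * DeltaW D ((l : ℝ) / ((D : ℝ) * p * k))

/-! ## u013: the principal character -/

/-- `Z22:§14.u013` OBJECT. The `θ = ψ⁰_{Dk}` term of the right side of (14.7):
`Σ_d d⁻¹ Σ_k a*(dk)/(kφ(Dk)) · τ(ψ̄⁰)ψ̄⁰(p) Σ_l κ*(dl)ψ⁰(−l)Δ(l/(Dpk))` ("then `τ(θ̄) = μ(Dk)`", `Step14p78`).
[cite: Zhang2022LandauSiegel, §14 u013 p.78, tex L3928–L3930] -/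
def princ147 (D p : ℕ) (κs as : ℕ → ℂ) : ℂ :=
  ∑ d ∈ Finset.Icc 1 ⌊2 * P4 D⌋₊, (d : ℂ)⁻¹ * ∑ k ∈ Finset.Icc 1 ⌊2 * P4 D⌋₊,
    as (d * k) / ((k : ℂ) * Nat.totient (D * k)) *
      (tauSum (D * k) (1 : DirichletCharacter ℂ (D * k))⁻¹ *
          (1 : DirichletCharacter ℂ (D * k))⁻¹ (p : ZMod (D * k)) *
        ∑' l : ℕ, κs (d * l) * (1 : DirichletCharacter ℂ (D * k)) (-(l : ZMod (D * k))) *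
          DeltaW D ((l : ℝ) / ((D : ℝ) * p * k)))

/-- `Z22:§14.u013` (prose, p. 78) CLAIM: "If `θ` is the principal character `ψ⁰_{Dk}`, then
`τ(θ̄) = μ(Dk)`" (classical: the Ramanujan sum `c_N(1) = μ(N)`), for every modulus `N ≥ 1`.
[cite: Zhang2022LandauSiegel, §14 u013 p.78, tex L3928] -/
def Step14p78 : Prop :=
  ∀ N : ℕ, 0 < N →
    tauSum N (1 : DirichletCharacter ℂ N)⁻¹ = (ArithmeticFunction.moebius N : ℂ)

/-- `Z22:§14.u013` OBJECT. The majorant of u013: `Σ_d d⁻¹ Σ_k Σ_l |κ*(dl)a*(dk)|/(φ(Dk)k) |Δ(l/(Dpk))|` (PRINT DEFECT: printed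
`|(κ₁∗b)(dl)a*(dk)|`, the §15 specialisation `κ* = κ₁∗b`; typed with `κ*`, cf. u009).
[cite: Zhang2022LandauSiegel, §14 u013 p.78, tex L3930] -/
def major1413 (D p : ℕ) (κs as : ℕ → ℂ) : ℝ :=
  ∑ d ∈ Finset.Icc 1 ⌊2 * P4 D⌋₊, (d : ℝ)⁻¹ * ∑ k ∈ Finset.Icc 1 ⌊2 * P4 D⌋₊,
    ∑' l : ℕ, ‖κs (d * l) * as (d * k)‖ / ((Nat.totient (D * k) : ℝ) * k) *
      ‖DeltaW D ((l : ℝ) / ((D : ℝ) * p * k))‖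

/-- `Z22:§14.u013` CLAIM (first `≪`). **u013** (p. 78): "The total contribution from the `θ = ψ⁰_{Dk}` term to the right side
[of (14.7)] is `≪ Σ_d d⁻¹ Σ_k Σ_l |κ*(dl)a*(dk)|/(φ(Dk)k)|Δ(l/(Dpk))|`". CLAIM.
[cite: Zhang2022LandauSiegel, §14 u013 p.78, tex L3930] -/
def Step14u013a : Prop :=
  ∀ B : ℝ, ∃ C : ℝ, ForAllLarge fun D _ _ => ∀ p ∈ primeWindow D, ∀ κs as : ℕ → ℂ,
    Eq141 B κs → Eq142 D B as → ‖princ147 D p κs as‖ ≤ C * major1413 D p κs as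

/-- `Z22:§14.u013` CLAIM (second `≪`). **u013** (p. 78): "[the majorant] `≪ P𝓛ᶜ`, by Lemma 5.3, which is admissible for (14.5)".
CLAIM. [cite: Zhang2022LandauSiegel, §14 u013 p.78, tex L3930] -/
def Step14u013b : Prop :=
  ∀ B : ℝ, ∃ c : ℝ, ∃ C : ℝ, ForAllLarge fun D _ χ => AssumptionA D χ →
    ∀ p ∈ primeWindow D, ∀ κs as : ℕ → ℂ, Eq141 B κs → Eq142 D B as →
      major1413 D p κs as ≤ C * bigP D * ell D ^ c

/-! ## u014, u015: the character induced by `χ` -/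

/-- `Z22:§14.u014` OBJECT. **`θ_k¹`** (p. 78): "the character `(mod Dk)` induced by the primitive character `χ (mod D)`".
[cite: Zhang2022LandauSiegel, §14 u014 p.78, tex L3932] -/
def thetaOne (k : ℕ) : DirichletCharacter ℂ (D * k) :=
  DirichletCharacter.changeLevel (dvd_mul_right D k) χ

omit [NeZero D] in
/-- `Z22:§14.u014` CLAIM. **u014** (p. 78): "Then `τ(θ_k¹)θ_k¹(p)θ_k¹(−l) = τ(χ)μχ(k)χ(−pl)`" (for `(p,Dk) = (l,Dk) = 1`, the standing
assumptions of u012). CLAIM. [cite: Zhang2022LandauSiegel, §14 u014 p.78, tex L3934] -/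
def Step14u014 : Prop :=
  ∀ (D : ℕ) [NeZero D] (χ : DirichletCharacter ℂ D), χ.IsPrimitive → ∀ k p l : ℕ, 0 < k →
    Nat.Coprime p (D * k) → Nat.Coprime l (D * k) →
      tauSum (D * k) (thetaOne χ k) * thetaOne χ k (p : ZMod (D * k)) *
          thetaOne χ k (-(l : ZMod (D * k))) =
        GammaFactor.tau χ * (ArithmeticFunction.moebius k : ℂ) * χ (k : ZMod D) *
          χ (-((p * l : ℕ) : ZMod D))

/-- `Z22:§14.u015` CLAIM. **u015** (p. 78): "Hence `Σ_d d⁻¹ Σ_k Σ_{(l,Dk)=1} κ*(dl)a*(dk)/(φ(Dk)k) Δ(l/(Dpk)) τ(θ_k¹)θ_k¹(p)θ_k¹(−l)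
= χ(−p)τ(χ)/φ(D) Σ_d d⁻¹ Σ_k μχ(k)a*(dk)/(kφ(k)) Σ_{(l,k)=1} χ(l)κ*(dl)Δ(l/(Dpk))`", for `p ∼ P` under
(14.1)–(14.2). CLAIM. [cite: Zhang2022LandauSiegel, §14 u015 p.78, tex L3938] -/
def Step14u015 : Prop :=
  ∀ B : ℝ, ForAllLarge fun D _ χ => ∀ p ∈ primeWindow D, ∀ κs as : ℕ → ℂ,
    Eq141 B κs → Eq142 D B as →
      (∑ d ∈ Finset.Icc 1 ⌊2 * P4 D⌋₊, (d : ℂ)⁻¹ * ∑ k ∈ Finset.Icc 1 ⌊2 * P4 D⌋₊,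
          ∑' l : ℕ, if Nat.Coprime l (D * k) then
            κs (d * l) * as (d * k) / ((Nat.totient (D * k) : ℂ) * k) *
              DeltaW D ((l : ℝ) / ((D : ℝ) * p * k)) *
                (tauSum (D * k) (thetaOne χ k) * thetaOne χ k (p : ZMod (D * k)) *
                  thetaOne χ k (-(l : ZMod (D * k)))) else 0) =
        χ (-(p : ZMod D)) * GammaFactor.tau χ / Nat.totient D * mainSum14 χ p κs as

/-! ## (14.8), u016, u017: the remaining characters -/

/-- `Z22:(14.8)` OBJECT. **The left side of (14.8)**: `Σ_d d⁻¹ Σ_k |a*(dk)|/(φ(Dk)k) Σ'_{θ (mod Dk), θ ≠ θ_k¹} |τ(θ̄)|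
|Σ_l κ*(dl)θ(l) Σ_{p∼P} χθ̄(p)Δ(l/(Dpk))|` (`Σ'` over the non-principal `θ`; `θ(l)` as printed, where
(14.7) has `θ(−l)` — the same absolute value; `χθ̄(p)` = `χ(p)θ̄(p)`).
[cite: Zhang2022LandauSiegel, §14 (14.8) p.79, tex L3945] -/
def lhs148 (κs as : ℕ → ℂ) : ℝ :=
  ∑ d ∈ Finset.Icc 1 ⌊2 * P4 D⌋₊, (d : ℝ)⁻¹ * ∑ k ∈ Finset.Icc 1 ⌊2 * P4 D⌋₊,
    ‖as (d * k)‖ / ((Nat.totient (D * k) : ℝ) * k) *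
      ∑ θ ∈ finsetOf {θ : DirichletCharacter ℂ (D * k) | θ ≠ 1 ∧ θ ≠ thetaOne χ k},
        ‖tauSum (D * k) θ⁻¹‖ *
          ‖∑' l : ℕ, κs (d * l) * θ (l : ZMod (D * k)) *
              ∑ p ∈ primeWindow D, χ (p : ZMod D) * θ⁻¹ (p : ZMod (D * k)) *
                DeltaW D ((l : ℝ) / ((D : ℝ) * p * k))‖

/-- `Z22:(14.8)` CLAIM. **(14.8)** (p. 79): "to complete the proof of (14.5), it now suffices to show that the total contribution
from the terms with `θ ≠ ψ⁰_{Dk}` and `θ ≠ θ_k¹` in (14.7) to the left side of (14.5) is `O(P²D^{−c})`.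
Namely we need to prove [`lhs148`] `≪ P²D^{−c}`". CLAIM. [cite: Zhang2022LandauSiegel, §14 (14.8) p.79, tex L3945] -/
def Eq148 : Prop :=
  ∀ B : ℝ, ∃ c : ℝ, 0 < c ∧ ∃ C : ℝ, ForAllLarge fun D _ χ => AssumptionA D χ →
    ∀ κs as : ℕ → ℂ, Eq141 B κs → Eq142 D B as →
      lhs148 χ κs as ≤ C * bigP D ^ 2 * (D : ℝ) ^ (-c)

omit [NeZero D] in
/-- `Z22:§14.u016` CLAIM. **u016** (p. 79): "For `r ∣ Dk` we have `Dk/r ≡ 0 (mod D/(D,r))`". CLAIM (elementary; see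
`step14u016_holds`). [cite: Zhang2022LandauSiegel, §14 u016 p.79, tex L3952] -/
def Step14u016 : Prop :=
  ∀ D k r : ℕ, r ∣ D * k → D / Nat.gcd D r ∣ D * k / r

/-- `Z22:§14.u017` OBJECT. **The right side of u017**: `Σ_d d⁻¹ Σ_{1<r<2DP₄} Σ_{h<P/r, h≡0 (D/(D,r))} D/(φ(hr)h√r)
Σ*_{θ (mod r), θ≠χ} |Σ_{(l,h)=1} κ*(dl)θ(l) Σ_{p∼P} χθ̄(p)Δ(l/(phr))|` (`Σ*` over primitive `θ (mod r)`;
"`θ ≠ χ`" as characters to the common modulus `Dr`, as in `Skeleton.Lemma56`).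
[cite: Zhang2022LandauSiegel, §14 u017 p.79, tex L3956] -/
def rhs1417 (κs : ℕ → ℂ) : ℝ :=
  ∑ d ∈ Finset.Icc 1 ⌊2 * P4 D⌋₊, (d : ℝ)⁻¹ * ∑ r ∈ Finset.Ico 2 ⌈2 * (D : ℝ) * P4 D⌉₊,
    ∑ h ∈ (Finset.Ico 1 ⌈bigP D / r⌉₊).filter (fun h => D / Nat.gcd D r ∣ h),
      (D : ℝ) / ((Nat.totient (h * r) : ℝ) * h * Real.sqrt r) *
        ∑ θ ∈ finsetOf {θ : DirichletCharacter ℂ r | θ.IsPrimitive ∧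
            DirichletCharacter.changeLevel (dvd_mul_left r D) θ ≠
              DirichletCharacter.changeLevel (dvd_mul_right D r) χ},
          ‖∑' l : ℕ, if Nat.Coprime l h then
              κs (d * l) * θ (l : ZMod r) *
                ∑ p ∈ primeWindow D, χ (p : ZMod D) * θ⁻¹ (p : ZMod r) *
                  DeltaW D ((l : ℝ) / ((p : ℝ) * h * r)) else 0‖

/-- `Z22:§14.u017` CLAIM. **u017** (p. 79): "If `θ (mod Dk)` is induced by a primitive character `θ* (mod r)`, then `r ∣ Dk` and
`|τ(θ̄)| ≤ √r` … Thus, substituting `Dk = hr`, we see that the left side of (14.8) is `≪` [`rhs1417`]".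
CLAIM. [cite: Zhang2022LandauSiegel, §14 u017 p.79, tex L3956] -/
def Step14u017 : Prop :=
  ∀ B : ℝ, ∃ C : ℝ, ForAllLarge fun D _ χ => AssumptionA D χ → ∀ κs as : ℕ → ℂ,
    Eq141 B κs → Eq142 D B as → lhs148 χ κs as ≤ C * rhs1417 χ κs

/-- `Z22:(14.8)` DEDUCTION CLAIM. **(14.8) ⇐ u017** (p. 79): "The range for `r` is divided into two parts … for `1 < r < D³` we use the
Mellin transform, Lemma 5.4 (i) and Lemma 5.6; for `D³ ≤ r < 2DP₄` we use the Mellin transform,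
Lemma 5.4 (i) and the large sieve inequality. Thus we obtain (14.5)", as a named implication (the large
sieve inequality is a theorem, not a hypothesis). CLAIM. [cite: Zhang2022LandauSiegel, §14 (14.8) (proof) p.79, tex L3960–L3963] -/
def DedEq148 : Prop := Step14u017 → Lemma54 → Lemma56 → Eq148

/-- `Z22:(14.5)` DEDUCTION CLAIM. **(14.5) ⇐ (14.7), u013, u015, (14.8)** (p. 79: "By the above discussion, to complete the proof of
(14.5), it now suffices to show … (14.8)"), as a named implication. CLAIM.
[cite: Zhang2022LandauSiegel, §14 (14.5) (proof) pp.78–79, tex L3918–L3950] -/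
def DedEq145 : Prop := Eq147 → Step14u013a → Step14u013b → Step14u015 → Eq148 → Eq145

/-- `Z22:(14.6)` DEDUCTION CLAIM. **(14.6) "is analogous"** (p. 79): "In the case `D = D₁D₂`, `D₁ > 1`, … the constraint `(k,D₁) = 1`
implies `D ∤ D₂k`, so that any non-principal character `θ (mod D₂k)` can not be induced by the real
character `χ (mod D)` … the main terms involved in the proof of (14.5) do not appear. This yields (14.6)",
as a named implication from the same two lemmas. CLAIM (no computation is printed).
[cite: Zhang2022LandauSiegel, §14 (14.6) (proof) p.79, tex L3966–L3969] -/
def DedEq146 : Prop := Lemma54 → Lemma56 → Eq146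

/-! ## The two prose facts about Gauss sums used on pp. 77 and 79 -/

/-- `Z22:§14.u006` (prose, p. 77) CLAIM: "`|τ(χψ_p⁰)| = √D`" — the Gauss sum, to the modulus `Dp`, of `χ` times the principal character
`ψ_p⁰ (mod p)`, for `p ∼ P` and `D` large (`p ∤ D`). CLAIM (classical: `τ = μ(p)χ(p)τ(χ)`).
[cite: Zhang2022LandauSiegel, §14 u006 p.77, tex L3864] -/
def Step14p77 : Prop :=
  ForAllLarge fun D _ χ => ∀ p ∈ primeWindow D,
    ‖tauSum (D * p) (DirichletCharacter.changeLevel (dvd_mul_right D p) χ *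
        DirichletCharacter.changeLevel (dvd_mul_left p D) (1 : DirichletCharacter ℂ p))‖ = Real.sqrt D

omit [NeZero D] χ in
/-- `Z22:§14.u017` (prose, p. 79) CLAIM: "If `θ (mod Dk)` is induced by a primitive character `θ* (mod r)`, then `r ∣ Dk` and
`|τ(θ̄)| ≤ √r`" (`r` = the conductor, `θ*` = Mathlib's `primitiveCharacter`). CLAIM (classical).
[cite: Zhang2022LandauSiegel, §14 u017 p.79, tex L3950] -/
def Step14p79 : Prop :=
  ∀ (N : ℕ) (θ : DirichletCharacter ℂ N), 0 < N →
    θ.conductor ∣ N ∧ ‖tauSum N θ⁻¹‖ ≤ Real.sqrt θ.conductor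

/-! ## Two elementary discharges (u007, u016) -/

/-- `Z22:§14.u016` DISCHARGED: **u016 holds**: `D/(D,r)` divides `Dk/r` whenever `r ∣ Dk`. [cite: Zhang2022LandauSiegel, §14 u016 p.79] -/
theorem step14u016_holds : Step14u016 := by
  intro D k r hr
  rcases Nat.eq_zero_or_pos r with rfl | hr0
  · rw [Nat.div_zero]; exact dvd_zero _
  · set g := Nat.gcd D r with hg
    have hg0 : 0 < g := Nat.gcd_pos_of_pos_right D hr0
    obtain ⟨D', hD'⟩ : g ∣ D := Nat.gcd_dvd_left D r
    obtain ⟨r', hr'⟩ : g ∣ r := Nat.gcd_dvd_right D r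
    have hcop : Nat.Coprime r' D' := by
      have := Nat.coprime_div_gcd_div_gcd (m := D) (n := r) hg0
      rw [← hg] at this
      rw [hD', hr', Nat.mul_div_cancel_left _ hg0, Nat.mul_div_cancel_left _ hg0] at this
      exact this.symm
    -- `r ∣ Dk` gives `r' ∣ D'k`, hence `r' ∣ k`
    have hr'k : r' ∣ k := by
      have h1 : g * r' ∣ g * (D' * k) := by rw [← hr', ← mul_assoc, ← hD']; exact hr
      have h2 : r' ∣ D' * k := (Nat.mul_dvd_mul_iff_left hg0).mp h1
      exact hcop.dvd_of_dvd_mul_left h2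
    obtain ⟨k', hk'⟩ := hr'k
    have hDg : D / g = D' := by rw [hD', Nat.mul_div_cancel_left _ hg0]
    have hr0' : 0 < r' := Nat.pos_of_ne_zero fun h => by simp [h] at hr'; omega
    have hDkr : D * k / r = D' * k' := by
      rw [hD', hk', hr']
      rw [show g * D' * (r' * k') = (g * r') * (D' * k') by ring]
      exact Nat.mul_div_cancel_left _ (Nat.mul_pos hg0 hr0')
    rw [hDg, hDkr]
    exact dvd_mul_right D' k'

/-- `Step14u016` — `_holds` alias of `step14u016_holds` above under the fact's exact name (appended
2026-08-28, D-0026 bookkeeping: the proof term is the existing theorem of this file; no statement,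
definition or attribute is edited; no new named fact; the ledger's debt table listed the fact
unproved). [cite: Zhang2022LandauSiegel, §14 u016 p.79] -/
theorem _root_.Literature.NumberTheory.LFunctions.Zhang2022.Typed.Sec14.Step14u016_holds :
    Step14u016 :=
  _root_.Literature.NumberTheory.LFunctions.Zhang2022.Typed.Sec14.step14u016_holds


/-! ## Appendix (G-adj2-4): the two `r`-ranges of u017 as separate claims, and elementary discharges -/

/-- `Z22:§14.u017` OBJECT (restricted `r`-range). The right side of u017 with the `r`-sum restricted to
`r ∈ S`: "The range for `r` is divided into two parts according to `1 < r < D³` and `D³ ≤ r < 2DP₄`"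
(p. 79). [cite: Zhang2022LandauSiegel, §14 u017 p.79, tex L3960] -/
def rhs1417On (κs : ℕ → ℂ) (S : Finset ℕ) : ℝ :=
  ∑ d ∈ Finset.Icc 1 ⌊2 * P4 D⌋₊, (d : ℝ)⁻¹ * ∑ r ∈ S,
    ∑ h ∈ (Finset.Ico 1 ⌈bigP D / r⌉₊).filter (fun h => D / Nat.gcd D r ∣ h),
      (D : ℝ) / ((Nat.totient (h * r) : ℝ) * h * Real.sqrt r) *
        ∑ θ ∈ finsetOf {θ : DirichletCharacter ℂ r | θ.IsPrimitive ∧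
            DirichletCharacter.changeLevel (dvd_mul_left r D) θ ≠
              DirichletCharacter.changeLevel (dvd_mul_right D r) χ},
          ‖∑' l : ℕ, if Nat.Coprime l h then
              κs (d * l) * θ (l : ZMod r) *
                ∑ p ∈ primeWindow D, χ (p : ZMod D) * θ⁻¹ (p : ZMod r) *
                  DeltaW D ((l : ℝ) / ((p : ℝ) * h * r)) else 0‖

omit [NeZero D] in
/-- The full right side of u017 is the restricted one over `1 < r < 2DP₄` (definitional).
[cite: Zhang2022LandauSiegel, §14 u017 p.79, tex L3956] -/
theorem rhs1417_eq_on (κs : ℕ → ℂ) :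
    rhs1417 χ κs = rhs1417On χ κs (Finset.Ico 2 ⌈2 * (D : ℝ) * P4 D⌉₊) := rfl

/-- `Z22:§14.u017`/`Z22:(14.8)` CLAIM (first `r`-range, p. 79): "for `1 < r < D³` we use the Mellin
transform, Lemma 5.4 (i) and Lemma 5.6" — the part `1 < r < D³` of the u017 majorant is `≪ P²D^{−c}`
(the estimate the sentence asserts; no display is printed — decl wanted by plan/GAP-LEDGER G-adj2-4).
[cite: Zhang2022LandauSiegel, §14 (14.8) (proof) p.79, tex L3960–L3962] -/
def Eq148leg1 : Prop :=
  ∀ B : ℝ, ∃ c : ℝ, 0 < c ∧ ∃ C : ℝ, ForAllLarge fun D _ χ => AssumptionA D χ →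
    ∀ κs as : ℕ → ℂ, Eq141 B κs → Eq142 D B as →
      rhs1417On χ κs ((Finset.Ico 2 ⌈2 * (D : ℝ) * P4 D⌉₊).filter (fun r => r < D ^ 3))
        ≤ C * bigP D ^ 2 * (D : ℝ) ^ (-c)

/-- `Z22:§14.u017`/`Z22:(14.8)` CLAIM (second `r`-range, p. 79): "for `D³ ≤ r < 2DP₄` we use the Mellin
transform, Lemma 5.4 (i) and the large sieve inequality" — the part `D³ ≤ r < 2DP₄` of the u017
majorant is `≪ P²D^{−c}` (decl wanted by G-adj2-4). [cite: Zhang2022LandauSiegel, §14 (14.8) (proof) p.79, tex L3962–L3963] -/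
def Eq148leg2 : Prop :=
  ∀ B : ℝ, ∃ c : ℝ, 0 < c ∧ ∃ C : ℝ, ForAllLarge fun D _ χ => AssumptionA D χ →
    ∀ κs as : ℕ → ℂ, Eq141 B κs → Eq142 D B as →
      rhs1417On χ κs ((Finset.Ico 2 ⌈2 * (D : ℝ) * P4 D⌉₊).filter (fun r => ¬ r < D ^ 3))
        ≤ C * bigP D ^ 2 * (D : ℝ) ^ (-c)

/-- `Z22:(14.8)` DEDUCTION CLAIM (first leg): "Mellin transform, Lemma 5.4 (i) and Lemma 5.6" give the
`1 < r < D³` estimate. [cite: Zhang2022LandauSiegel, §14 (14.8) (proof) p.79, tex L3960–L3962] -/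
def DedEq148leg1 : Prop := Lemma54 → Lemma56 → Eq148leg1

/-- `Z22:(14.8)` DEDUCTION CLAIM (second leg): "Mellin transform, Lemma 5.4 (i) and the large sieve
inequality" (the large sieve over `Ψ`: Lemma 3.3 (ii), `Skeleton.Lemma33b`, as at (7.5)) give the
`D³ ≤ r < 2DP₄` estimate. [cite: Zhang2022LandauSiegel, §14 (14.8) (proof) p.79, tex L3962–L3963] -/
def DedEq148leg2 : Prop := Lemma54 → Lemma33b → Eq148leg2

omit [NeZero D] in
/-- Every term of the u017 majorant is non-negative. [cite: Zhang2022LandauSiegel, §14 u017 p.79] -/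
theorem rhs1417On_nonneg (κs : ℕ → ℂ) (S : Finset ℕ) : 0 ≤ rhs1417On χ κs S := by
  unfold rhs1417On
  refine Finset.sum_nonneg fun d _ => mul_nonneg (inv_nonneg.mpr (Nat.cast_nonneg d)) ?_
  refine Finset.sum_nonneg fun r _ => Finset.sum_nonneg fun h _ => mul_nonneg ?_ ?_
  · exact div_nonneg (Nat.cast_nonneg D)
      (mul_nonneg (mul_nonneg (Nat.cast_nonneg _) (Nat.cast_nonneg h)) (Real.sqrt_nonneg r))
  · exact Finset.sum_nonneg fun θ _ => norm_nonneg _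

omit [NeZero D] in
/-- The u017 majorant splits over the two `r`-ranges. [cite: Zhang2022LandauSiegel, §14 u017 p.79, tex L3960] -/
theorem rhs1417_eq_legs (κs : ℕ → ℂ) :
    rhs1417 χ κs =
      rhs1417On χ κs ((Finset.Ico 2 ⌈2 * (D : ℝ) * P4 D⌉₊).filter (fun r => r < D ^ 3)) +
      rhs1417On χ κs ((Finset.Ico 2 ⌈2 * (D : ℝ) * P4 D⌉₊).filter (fun r => ¬ r < D ^ 3)) := by
  rw [rhs1417_eq_on, rhs1417On, rhs1417On, rhs1417On, ← Finset.sum_add_distrib]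
  refine Finset.sum_congr rfl fun d _ => ?_
  rw [← mul_add, Finset.sum_filter_add_sum_filter_not]

/-- **(14.8) ⇐ u017 + the two `r`-range estimates** — the bookkeeping edge, kernel-checked: with
`c = min(c₁,c₂)` and `C = |C₀|(|C₁| + |C₂|)`. [cite: Zhang2022LandauSiegel, §14 (14.8) (proof) p.79, tex L3956–L3963] -/
theorem eq148_of_legs (h17 : Step14u017) (h1 : Eq148leg1) (h2 : Eq148leg2) : Eq148 := by
  intro B
  obtain ⟨C₀, h17⟩ := h17 B
  obtain ⟨c₁, hc₁, C₁, h1⟩ := h1 B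
  obtain ⟨c₂, hc₂, C₂, h2⟩ := h2 B
  refine ⟨min c₁ c₂, lt_min hc₁ hc₂, |C₀| * (|C₁| + |C₂|), ?_⟩
  obtain ⟨D₀, hD₀⟩ := (h17.and h1).and h2
  refine ⟨max D₀ 1, fun D _ χ hD hq hp hA κs as hκ ha => ?_⟩
  obtain ⟨⟨e17, e1⟩, e2⟩ := hD₀ D χ (le_trans (le_max_left _ _) hD) hq hp
  have hD1 : (1 : ℝ) ≤ D := by exact_mod_cast le_trans (le_max_right _ _) hD
  have g17 := e17 hA κs as hκ ha
  have g1 := e1 hA κs as hκ ha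
  have g2 := e2 hA κs as hκ ha
  set L₁ := rhs1417On χ κs ((Finset.Ico 2 ⌈2 * (D : ℝ) * P4 D⌉₊).filter (fun r => r < D ^ 3))
  set L₂ := rhs1417On χ κs ((Finset.Ico 2 ⌈2 * (D : ℝ) * P4 D⌉₊).filter (fun r => ¬ r < D ^ 3))
  have hL₁ : 0 ≤ L₁ := rhs1417On_nonneg χ κs _
  have hL₂ : 0 ≤ L₂ := rhs1417On_nonneg χ κs _
  have hP : 0 ≤ bigP D ^ 2 := sq_nonneg _
  have hpow₁ : (D : ℝ) ^ (-c₁) ≤ (D : ℝ) ^ (-min c₁ c₂) :=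
    Real.rpow_le_rpow_of_exponent_le hD1 (neg_le_neg (min_le_left c₁ c₂))
  have hpow₂ : (D : ℝ) ^ (-c₂) ≤ (D : ℝ) ^ (-min c₁ c₂) :=
    Real.rpow_le_rpow_of_exponent_le hD1 (neg_le_neg (min_le_right c₁ c₂))
  have hD0 : (0 : ℝ) ≤ D := Nat.cast_nonneg D
  have k1 : L₁ ≤ |C₁| * bigP D ^ 2 * (D : ℝ) ^ (-min c₁ c₂) :=
    calc L₁ ≤ C₁ * bigP D ^ 2 * (D : ℝ) ^ (-c₁) := g1
      _ ≤ |C₁| * bigP D ^ 2 * (D : ℝ) ^ (-c₁) := by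
          gcongr
          exact le_abs_self C₁
      _ ≤ |C₁| * bigP D ^ 2 * (D : ℝ) ^ (-min c₁ c₂) := by gcongr
  have k2 : L₂ ≤ |C₂| * bigP D ^ 2 * (D : ℝ) ^ (-min c₁ c₂) :=
    calc L₂ ≤ C₂ * bigP D ^ 2 * (D : ℝ) ^ (-c₂) := g2
      _ ≤ |C₂| * bigP D ^ 2 * (D : ℝ) ^ (-c₂) := by
          gcongr
          exact le_abs_self C₂
      _ ≤ |C₂| * bigP D ^ 2 * (D : ℝ) ^ (-min c₁ c₂) := by gcongr
  calc lhs148 χ κs as ≤ C₀ * rhs1417 χ κs := g17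
    _ ≤ |C₀| * rhs1417 χ κs := by
        rw [rhs1417_eq_legs] at *
        exact mul_le_mul_of_nonneg_right (le_abs_self C₀) (add_nonneg hL₁ hL₂)
    _ = |C₀| * (L₁ + L₂) := by rw [rhs1417_eq_legs]
    _ ≤ |C₀| * (|C₁| * bigP D ^ 2 * (D : ℝ) ^ (-min c₁ c₂) +
          |C₂| * bigP D ^ 2 * (D : ℝ) ^ (-min c₁ c₂)) := by
        exact mul_le_mul_of_nonneg_left (add_le_add k1 k2) (abs_nonneg C₀)
    _ = |C₀| * (|C₁| + |C₂|) * bigP D ^ 2 * (D : ℝ) ^ (-min c₁ c₂) := by ring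

/-- `Z22:§14.u007` DISCHARGED: the reciprocity of modular inverses behind
"`D̄k̄/p ≡ −p̄/(Dk) + 1/(Dpk) (mod 1)`". [cite: Zhang2022LandauSiegel, §14 u007 p.77, tex L3873] -/
theorem step14u007_holds : Step14u007 := by
  intro D k p hD hk hp hcop
  set N := D * k with hN
  have hN0 : 0 < N := Nat.mul_pos hD hk
  haveI : NeZero N := ⟨hN0.ne'⟩
  haveI : Fact p.Prime := ⟨hp⟩
  -- `a = (Dk)⁻¹ mod p`, `b = p⁻¹ mod Dk`
  set a := nInv p N with ha
  set b := nInv N p with hb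
  have hcop' : Nat.Coprime N p := hcop.symm
  -- `N * a ≡ 1 (mod p)`
  have h1 : N * a ≡ 1 [MOD p] := by
    rw [← ZMod.natCast_eq_natCast_iff, Nat.cast_mul, Nat.cast_one, ha, nInv, ZMod.natCast_zmod_val]
    exact ZMod.coe_mul_inv_eq_one N hcop'
  -- `p * b ≡ 1 (mod N)`
  have h2 : p * b ≡ 1 [MOD N] := by
    rw [← ZMod.natCast_eq_natCast_iff, Nat.cast_mul, Nat.cast_one, hb, nInv, ZMod.natCast_zmod_val]
    exact ZMod.coe_mul_inv_eq_one p hcop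
  -- `S = N a + p b ≡ 1` modulo `p` and modulo `N`, hence modulo `pN`
  have hS1 : N * a + p * b ≡ 1 [MOD p] := by
    have : p * b ≡ 0 [MOD p] := (Nat.modEq_zero_iff_dvd.mpr (dvd_mul_right p b))
    simpa using h1.add this
  have hS2 : N * a + p * b ≡ 1 [MOD N] := by
    have : N * a ≡ 0 [MOD N] := (Nat.modEq_zero_iff_dvd.mpr (dvd_mul_right N a))
    simpa using this.add h2
  have hS : N * a + p * b ≡ 1 [MOD p * N] := (Nat.modEq_and_modEq_iff_modEq_mul hcop).mp ⟨hS1, hS2⟩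
  obtain ⟨M, hM⟩ := (Nat.modEq_iff_dvd.mp hS.symm)
  -- `hM : (N a + p b : ℤ) - 1 = (p N) * M`
  refine ⟨M, ?_⟩
  have hp0 : (0 : ℝ) < p := by exact_mod_cast hp.pos
  have hD0 : (0 : ℝ) < D := by exact_mod_cast hD
  have hk0 : (0 : ℝ) < k := by exact_mod_cast hk
  have key : ((D : ℝ) * k) * a + p * b = 1 + p * (D * k) * M := by
    have h := congrArg (fun z : ℤ => (z : ℝ)) hM
    simp only [hN] at h
    push_cast at h
    linarith
  field_simp
  linear_combination key

/-- `Step14u007` — `_holds` alias of `step14u007_holds` above under the fact's exact name (appended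
2026-08-28, D-0026 bookkeeping: the proof term is the existing theorem of this file; no statement,
definition or attribute is edited; no new named fact; the ledger's debt table listed the fact
unproved). [cite: Zhang2022LandauSiegel, §14 u007 p.77, tex L3873] -/
theorem _root_.Literature.NumberTheory.LFunctions.Zhang2022.Typed.Sec14.Step14u007_holds :
    Step14u007 :=
  _root_.Literature.NumberTheory.LFunctions.Zhang2022.Typed.Sec14.step14u007_holds

/-- `Z22:§14.u008` DISCHARGED: `Δ₁(l/(Dpk))e(lD̄k̄/p) = Δ(l/(Dpk))e(−lp̄/(Dk))`, from u007 and
`Δ = Δ₁·e` (5.7). [cite: Zhang2022LandauSiegel, §14 u008 p.77, tex L3877] -/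
theorem step14u008_holds : Step14u008 := by
  intro D k p l hD hk hp hcop
  obtain ⟨N, hN⟩ := step14u007_holds D k p hD hk hp hcop
  set A : ℝ := (l : ℝ) * nInv (D * k) p / (D * k) with hA
  set X : ℝ := (l : ℝ) / ((D : ℝ) * p * k) with hX
  have hx : (l : ℝ) * (nInv p (D * k) : ℝ) / p = -A + X + ((l * N : ℤ) : ℝ) := by
    have : (l : ℝ) * (nInv p (D * k) : ℝ) / p = l * ((nInv p (D * k) : ℝ) / p) := by ring
    rw [this, hN, hA, hX]
    push_cast
    ring
  have hΔ : DeltaW D X = Lemma53.Delta1_56 (ell2 D) (t0 D) X * cexp (2 * π * I * (X : ℂ)) := rfl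
  rw [hΔ, hx, eAdd, eAdd]
  have harg : 2 * π * I * (((-A + X + ((l * N : ℤ) : ℝ)) : ℝ) : ℂ) =
      (2 * π * I * (X : ℂ) + 2 * π * I * ((-A : ℝ) : ℂ)) + ((l * N : ℤ) : ℂ) * (2 * π * I) := by
    push_cast
    ring
  rw [harg, Complex.exp_add, Complex.exp_int_mul_two_pi_mul_I, mul_one, Complex.exp_add]
  ring

/-- `Step14u008` — `_holds` alias of `step14u008_holds` above under the fact's exact name (appended
2026-08-28, D-0026 bookkeeping: the proof term is the existing theorem of this file; no statement,
definition or attribute is edited; no new named fact; the ledger's debt table listed the fact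
unproved). [cite: Zhang2022LandauSiegel, §14 u008 p.77, tex L3877] -/
theorem _root_.Literature.NumberTheory.LFunctions.Zhang2022.Typed.Sec14.Step14u008_holds :
    Step14u008 :=
  _root_.Literature.NumberTheory.LFunctions.Zhang2022.Typed.Sec14.step14u008_holds

/-- `e` is `1`-periodic: `e(y + t) = e(y)` for an integer `t`. [folklore] -/
private theorem eAdd_add_int (y : ℝ) (t : ℤ) : eAdd (y + t) = eAdd y := by
  rw [eAdd, eAdd]
  have : 2 * π * I * (((y + t : ℝ)) : ℂ) = 2 * π * I * (y : ℂ) + (t : ℂ) * (2 * π * I) := by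
    push_cast; ring
  rw [this, Complex.exp_add, Complex.exp_int_mul_two_pi_mul_I, mul_one]

/-- For all characters `θ (mod N)`: `Σ_θ θ⁻¹(a)θ⁻¹(p)θ(−l) = φ(N)·[ap ≡ −l]` when `(l,N) = (p,N) = 1`
(orthogonality, Mathlib's `DirichletCharacter.sum_characters_eq`). [folklore] -/
private theorem sum_char_inv_inv_mul {N : ℕ} [NeZero N] (a p l : ℕ) (hl : Nat.Coprime l N)
    (hp : Nat.Coprime p N) :
    ∑ θ : DirichletCharacter ℂ N,
        θ⁻¹ (a : ZMod N) * θ (-(l : ZMod N)) * θ⁻¹ (p : ZMod N) =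
      if (a : ZMod N) = -(l : ZMod N) * (p : ZMod N)⁻¹ then (N.totient : ℂ) else 0 := by
  have hpu : IsUnit (p : ZMod N) := (ZMod.isUnit_iff_coprime p N).mpr hp
  have hlu : IsUnit (-(l : ZMod N)) := ((ZMod.isUnit_iff_coprime l N).mpr hl).neg
  -- rewrite the summand as `θ (Ring.inverse (a p) · (−l))`
  have hterm : ∀ θ : DirichletCharacter ℂ N,
      θ⁻¹ (a : ZMod N) * θ (-(l : ZMod N)) * θ⁻¹ (p : ZMod N) =
        θ (Ring.inverse ((a : ZMod N) * p) * -(l : ZMod N)) := by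
    intro θ
    rw [map_mul, ← MulChar.inv_apply, map_mul]
    ring
  rw [Finset.sum_congr rfl fun θ _ => hterm θ, DirichletCharacter.sum_characters_eq]
  -- the two conditions agree
  have hiff : Ring.inverse ((a : ZMod N) * p) * -(l : ZMod N) = 1 ↔
      (a : ZMod N) = -(l : ZMod N) * (p : ZMod N)⁻¹ := by
    by_cases hu : IsUnit ((a : ZMod N) * p)
    · constructor
      · intro h
        have h2 : (a : ZMod N) * p = -(l : ZMod N) := by
          have := congrArg (fun z => (a : ZMod N) * p * z) h
          simpa [← mul_assoc, Ring.mul_inverse_cancel _ hu] using this.symm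
        calc (a : ZMod N) = (a : ZMod N) * p * (p : ZMod N)⁻¹ := by
              rw [mul_assoc, ZMod.mul_inv_of_unit _ hpu, mul_one]
          _ = -(l : ZMod N) * (p : ZMod N)⁻¹ := by rw [h2]
      · intro h
        have h2 : (a : ZMod N) * p = -(l : ZMod N) := by
          rw [h, mul_assoc, ZMod.inv_mul_of_unit _ hpu, mul_one]
        rw [h2] at hu ⊢
        have := Ring.inverse_mul_cancel _ hu
        exact this
    · have h0 : Ring.inverse ((a : ZMod N) * p) = 0 := Ring.inverse_non_unit _ hu
      rw [h0, zero_mul]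
      constructor
      · intro h
        -- `0 = 1` in `ZMod N` forces everything to be a unit
        haveI : Subsingleton (ZMod N) := subsingleton_of_zero_eq_one h
        exact absurd (isUnit_of_subsingleton ((a : ZMod N) * p)) hu
      · intro h
        exfalso
        apply hu
        rw [h, mul_assoc, ZMod.inv_mul_of_unit _ hpu, mul_one]
        exact hlu
  by_cases hc : (a : ZMod N) = -(l : ZMod N) * (p : ZMod N)⁻¹
  · rw [if_pos hc, if_pos (hiff.mpr hc)]
  · rw [if_neg hc, if_neg (fun h => hc (hiff.mp h))]

/-- `Z22:§14.u012` DISCHARGED: `e(−lp̄/(Dk)) = φ(Dk)⁻¹Σ_{θ (mod Dk)} τ(θ̄)θ(−l)θ̄(p)` for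
`(l,Dk) = (p,Dk) = 1` (orthogonality of characters). [cite: Zhang2022LandauSiegel, §14 u012 p.78, tex L3920] -/
theorem step14u012_holds : Step14u012 := by
  intro D k p l hD hk hl hp
  set N := D * k with hN
  have hN0 : 0 < N := Nat.mul_pos hD hk
  haveI : NeZero N := ⟨hN0.ne'⟩
  have hpu : IsUnit (p : ZMod N) := (ZMod.isUnit_iff_coprime p N).mpr hp
  -- the sum over `finsetOf univ` is the sum over all characters
  have hfs : finsetOf (Set.univ : Set (DirichletCharacter ℂ N)) = Finset.univ := by
    ext θ; simp [mem_finsetOf Set.finite_univ]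
  -- the distinguished residue `c = −l·p̄`
  set c : ZMod N := -(l : ZMod N) * (p : ZMod N)⁻¹ with hc
  have hNR : ((D : ℝ) * k) = (N : ℝ) := by rw [hN]; push_cast; ring
  rw [hNR, hfs]
  -- Step 1: expand `τ`, swap the sums, apply orthogonality
  have step1 : ∑ θ : DirichletCharacter ℂ N,
      tauSum N θ⁻¹ * θ (-(l : ZMod N)) * θ⁻¹ (p : ZMod N) =
        ∑ a ∈ Finset.range N, eAdd ((a : ℝ) / N) *
          ∑ θ : DirichletCharacter ℂ N,
            θ⁻¹ (a : ZMod N) * θ (-(l : ZMod N)) * θ⁻¹ (p : ZMod N) := by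
    simp only [tauSum, Finset.sum_mul, Finset.mul_sum]
    rw [Finset.sum_comm]
    refine Finset.sum_congr rfl fun a _ => Finset.sum_congr rfl fun θ _ => by ring
  have step2 : ∑ a ∈ Finset.range N, eAdd ((a : ℝ) / N) *
      ∑ θ : DirichletCharacter ℂ N,
        θ⁻¹ (a : ZMod N) * θ (-(l : ZMod N)) * θ⁻¹ (p : ZMod N) =
      (N.totient : ℂ) * eAdd ((c.val : ℝ) / N) := by
    rw [Finset.sum_congr rfl fun a _ => by rw [sum_char_inv_inv_mul a p l hl hp]]
    have hcond : ∀ a ∈ Finset.range N, ((a : ZMod N) = c ↔ a = c.val) := by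
      intro a ha
      rw [Finset.mem_range] at ha
      constructor
      · intro h; rw [← h, ZMod.val_natCast_of_lt ha]
      · intro h; rw [h, ZMod.natCast_zmod_val]
    rw [Finset.sum_congr rfl fun a ha => by rw [← hc, if_congr (hcond a ha) rfl rfl]]
    simp_rw [mul_ite, mul_zero]
    rw [Finset.sum_ite_eq' (Finset.range N) c.val, if_pos (Finset.mem_range.mpr (ZMod.val_lt c))]
    ring
  rw [step1, step2, ← mul_assoc, inv_mul_cancel₀ (by exact_mod_cast (Nat.totient_pos.mpr hN0).ne'),
    one_mul]
  -- Step 3: `c ≡ −l·p̄ (mod N)` as integers, so the two `e(·)` agree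
  have hcz : (c : ZMod N) = (((-((l * nInv N p : ℕ) : ℤ)) : ℤ) : ZMod N) := by
    rw [hc, nInv]; push_cast; rw [ZMod.natCast_zmod_val]; ring
  have hcz' : ((c.val : ℤ) : ZMod N) = (((-((l * nInv N p : ℕ) : ℤ)) : ℤ) : ZMod N) := by
    rw [← hcz]; push_cast; rw [ZMod.natCast_zmod_val]
  obtain ⟨t, ht⟩ := (ZMod.intCast_eq_intCast_iff_dvd_sub _ _ _).mp hcz'.symm
  -- `ht : (c.val : ℤ) - (-(l b)) = N * t`
  have hreal : ((c.val : ℕ) : ℝ) / N = -((l : ℝ) * nInv N p / N) + (t : ℤ) := by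
    have hN0' : (N : ℝ) ≠ 0 := by exact_mod_cast hN0.ne'
    have h := congrArg (fun z : ℤ => (z : ℝ)) ht
    push_cast at h
    field_simp
    linarith
  rw [hreal, eAdd_add_int]

/-- `Step14u012` — `_holds` alias of `step14u012_holds` above under the fact's exact name (appended
2026-08-28, D-0026 bookkeeping: the proof term is the existing theorem of this file; no statement,
definition or attribute is edited; no new named fact; the ledger's debt table listed the fact
unproved). [cite: Zhang2022LandauSiegel, §14 u012 p.78, tex L3920] -/
theorem _root_.Literature.NumberTheory.LFunctions.Zhang2022.Typed.Sec14.Step14u012_holds :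
    Step14u012 :=
  _root_.Literature.NumberTheory.LFunctions.Zhang2022.Typed.Sec14.step14u012_holds

end Literature.NumberTheory.LFunctions.Zhang2022.Typed.Sec14
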